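import Summits.HubbardSuperconductivity.HubbardSuperconductivity.Theorems.ParentFirstSMAMottGap

/-!
# Stub `stub_twoSidedSingleModeBinding` (S2) of line `birth`
# (crux `BoundCoherentDWavePairs`, item stmt-HubbardSuperconductivity-10770, route `ParentFirstSMA`)

The two-sided single-mode binding criterion. Write `E(N) = groundEnergyAt (fermionTorusGraph 2 L) 1 U N`
and `Δ_b(L) = 2E(L²−1) − E(L²) − E(L²−2) = [E(L²−1) − E(L²−2)] − [E(L²) − E(L²−1)]` (two-hole
binding energy, clause (i) of the crux). BOTH brackets are variational relative to the one-hole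
ground state `φ` (sector `L²−1`): for doublon-commuting modes `A₁` (refill, `A₁φ` in sector `L²`)
and `A₂` (punch, `A₂φ` in sector `L²−2`), Feynman's single-mode bound
(`projectedSingleModeBound_proof`, the landed support `ProjectedSingleModeBound`) gives
`Z₁·(E(L²) − E(L²−1)) ≤ f₁` and `Z₂·(E(L²−2) − E(L²−1)) ≤ f₂` with `Zᵢ = Re⟨Aᵢφ, Aᵢφ⟩ ≥ 0`,
`fᵢ = Re⟨Aᵢφ, (TAᵢ − AᵢT)φ⟩`, `T = hubbardTorus 2 L 1 0` (`U` drops out of both first moments).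
Multiplying by `Z₂`, `Z₁` and adding: `Z₁Z₂·Δ_b(L) ≥ −(Z₂f₁ + Z₁f₂)`. Binding is thereby reduced to an
equal-time first-moment inequality on ONE state — the shape of crux #2.

No definitions are introduced.
-/

-- the mandated namespace `Summit.<Summit>.<Problem>.Theorems` repeats `HubbardSuperconductivity`
set_option linter.dupNamespace false

noncomputable section

namespace Summit.HubbardSuperconductivity.HubbardSuperconductivity.Theorems.ParentFirstSMA

open scoped Matrix ComplexOrder
open Literature.MathematicalPhysics.QuantumLattice
open Summit.HubbardSuperconductivity.HubbardSuperconductivity.Theses.ParentFirstSMA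

/-- **Stub S2 of line `birth` (crux `BoundCoherentDWavePairs`, stmt-HubbardSuperconductivity-10770):
the two-sided single-mode binding criterion.** For a one-hole ground state `φ` of
`hubbardTorus 2 L 1 U` and doublon-commuting `A₁`, `A₂` with `A₁φ` an `L²`-particle and `A₂φ` an
`(L²−2)`-particle vector, `−(Z₂f₁ + Z₁f₂) ≤ Z₁Z₂·(2E(L²−1) − E(L²) − E(L²−2))`: Feynman's bound
twice (`projectedSingleModeBound_proof` at `(N, M) = (L²−1, L²)` and `(L²−1, L²−2)`), weighted by
the nonnegative norms and added. [cite: LiebWuPhysicaA2003, §1 eq. (3)] -/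
theorem stub_twoSidedSingleModeBinding :
    ∀ (U : ℝ) (L : ℕ)
      (A₁ A₂ : Matrix (Finset (Orb (FermionTorus 2 L))) (Finset (Orb (FermionTorus 2 L))) ℂ)
      (φ : Fock (Orb (FermionTorus 2 L))),
      IsGroundState (hubbardTorus 2 L 1 U) (L ^ 2 - 1) φ →
      A₁ * (∑ x : FermionTorus 2 L, numberOp x 0 * numberOp x 1) =
        (∑ x : FermionTorus 2 L, numberOp x 0 * numberOp x 1) * A₁ →
      A₂ * (∑ x : FermionTorus 2 L, numberOp x 0 * numberOp x 1) =
        (∑ x : FermionTorus 2 L, numberOp x 0 * numberOp x 1) * A₂ →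
      IsNParticle (L ^ 2) (A₁ *ᵥ φ) → IsNParticle (L ^ 2 - 2) (A₂ *ᵥ φ) →
      -((star (A₂ *ᵥ φ) ⬝ᵥ (A₂ *ᵥ φ)).re *
            (star (A₁ *ᵥ φ) ⬝ᵥ ((hubbardTorus 2 L 1 0 * A₁ - A₁ * hubbardTorus 2 L 1 0) *ᵥ φ)).re +
          (star (A₁ *ᵥ φ) ⬝ᵥ (A₁ *ᵥ φ)).re *
            (star (A₂ *ᵥ φ) ⬝ᵥ ((hubbardTorus 2 L 1 0 * A₂ - A₂ * hubbardTorus 2 L 1 0) *ᵥ φ)).re) ≤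
        (star (A₁ *ᵥ φ) ⬝ᵥ (A₁ *ᵥ φ)).re * (star (A₂ *ᵥ φ) ⬝ᵥ (A₂ *ᵥ φ)).re *
          (2 * groundEnergyAt (fermionTorusGraph 2 L) 1 U (L ^ 2 - 1) -
            groundEnergyAt (fermionTorusGraph 2 L) 1 U (L ^ 2) -
            groundEnergyAt (fermionTorusGraph 2 L) 1 U (L ^ 2 - 2)) := by
  intro U L A₁ A₂ φ hGS hA₁ hA₂ hN₁ hN₂
  have h₁ := projectedSingleModeBound_proof U L (L ^ 2 - 1) (L ^ 2) A₁ φ hGS hA₁ hN₁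
  have h₂ := projectedSingleModeBound_proof U L (L ^ 2 - 1) (L ^ 2 - 2) A₂ φ hGS hA₂ hN₂
  have hZ₁ : 0 ≤ (star (A₁ *ᵥ φ) ⬝ᵥ (A₁ *ᵥ φ)).re :=
    (Complex.nonneg_iff.1 (dotProduct_star_self_nonneg _)).1
  have hZ₂ : 0 ≤ (star (A₂ *ᵥ φ) ⬝ᵥ (A₂ *ᵥ φ)).re :=
    (Complex.nonneg_iff.1 (dotProduct_star_self_nonneg _)).1
  have k₁ := mul_le_mul_of_nonneg_left h₁ hZ₂
  have k₂ := mul_le_mul_of_nonneg_left h₂ hZ₁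
  nlinarith [k₁, k₂]

end Summit.HubbardSuperconductivity.HubbardSuperconductivity.Theorems.ParentFirstSMA

end
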